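import Summits.Parity.GeneralizedHardyLittlewood.Theorems.PrimeLevelFamEdgeMomentsBeyondDiagonalDiagBoseB0Kernel
import Summits.Parity.GeneralizedHardyLittlewood.Theorems.PrimeLevelFamEdgeMomentsBeyondDiagonalDiagBoseB0Tools
import Summits.Parity.GeneralizedHardyLittlewood.Theorems.PrimeLevelFamEdgeMomentsBeyondDiagonalDiagBoseDecay
import HarnessLib

/-!
# Route `PrimeLevelFamEdge`, crux K_A `MomentsBeyondDiagonal` (stmt-Parity-20007), line «petersson_layers» v4, stub `stub_diag`:
# **census R2, first coefficient: `c_{a0}(y) = ∫₀^∞(log u)^a(e^{u+y/u}−1)⁻¹du = (−1)^a(½log(1/y))^{a+1}/(a+1) + O_a((1+log(1/y))^a)`**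

The leading small-`y` behaviour of the one-dimensional Bose coefficients `c_{a0}` (`…DiagBoseB0`), the first analytic
input of the general-`Q` diagonal beyond the `Q = 1` chain. Proof (all real-variable, `s = √y`): split `(0,∞)` at `1`
(`[1,∞)` is `O_a(1)` by `(e^{u+y/u}−1)⁻¹ ≤ 2e^{−u}`); on `(0,1]` replace the kernel by `u/(u²+y)` at cost `½∫₀¹|log u|^a`
(`…DiagBoseB0Kernel.abs_bose0_kernel_sub_le`); below `s` the weight is `≤ u/y` and `|log u|^a u ≤ 2^a(|log s|^a + Cₐ)s`
(`…DiagBoseB0Tools.abs_log_pow_mul_le`); on `[s,1]`, `u/(u²+y) = 1/u − y/(u(u²+y))`, the first part integrates to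
`−(log s)^{a+1}/(a+1)` (`integral_log_pow_div_eq`) and the second is `≤ |log s|^a·∫_s^1 y/u³ ≤ ½|log s|^a`.

* `bose_coeff_a0_leading` — the statement above, with a constant depending on `a` only, for `0 < y ≤ 1`.

Def-free; theorems only. Helper `--supports stmt-Parity-20007`; closes nothing; K_A, K_B and the Parity summit are NOT
proved; nothing about Landau–Siegel zeros.

## References
* E. Kowalski, P. Michel, J. VanderKam, J. reine angew. Math. 526 (2000), (22)–(28) pp. 12–15 (the residue polynomials
  of the diagonal weight). [cite: KowalskiMichelVanderKam2000, (22)–(28) — derivation (leading residue, real-variable form)]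
-/

noncomputable section

open Real Set MeasureTheory intervalIntegral

namespace Summit.Parity.GeneralizedHardyLittlewood.Theorems.MomentsBeyondDiagonal.DiagLines

open Summit.Parity.GeneralizedHardyLittlewood.Theorems.BeyondDiagonalBeatsQuarter.Corner
  (scriptW_integrand_le_const continuousOn_scriptW_integrand scriptW_integrand_nonneg)

/-- `∫_s^1 y/u³ du = y/(2s²) − y/2` for `0 < s ≤ 1`. [folklore] -/
theorem integral_div_cube_eq (y : ℝ) {s : ℝ} (hs0 : 0 < s) (hs1 : s ≤ 1) :
    ∫ u in s..1, y / u ^ 3 = y / (2 * s ^ 2) - y / 2 := by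
  have hderiv : ∀ u ∈ uIcc s 1, HasDerivAt (fun u : ℝ ↦ (-y / 2) * u ^ (-2 : ℤ)) (y / u ^ 3) u := by
    intro u hu
    rw [uIcc_of_le hs1] at hu
    have hu0 : 0 < u := lt_of_lt_of_le hs0 hu.1
    have h := (hasDerivAt_zpow (-2 : ℤ) u (Or.inl hu0.ne')).const_mul (-y / 2)
    refine h.congr_deriv ?_
    have hu' : u ≠ 0 := hu0.ne'
    rw [show (-2 : ℤ) - 1 = -(3 : ℕ) by norm_num, zpow_neg, zpow_natCast]
    push_cast
    field_simp
  have hcont : ContinuousOn (fun u : ℝ ↦ y / u ^ 3) (uIcc s 1) := by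
    rw [uIcc_of_le hs1]
    refine ContinuousOn.div continuousOn_const (continuousOn_pow 3) fun u hu ↦ ?_
    exact pow_ne_zero 3 (ne_of_gt (lt_of_lt_of_le hs0 hu.1))
  rw [integral_eq_sub_of_hasDerivAt hderiv (hcont.intervalIntegrable)]
  have hs' : s ≠ 0 := hs0.ne'
  rw [show (-2 : ℤ) = -(2 : ℕ) by norm_num, zpow_neg, zpow_neg, zpow_natCast, zpow_natCast, one_pow]
  field_simp
  ring

-- one long real-variable assembly (four integral pieces); the default budget times out at `whnf`
set_option maxHeartbeats 800000 in
/-- **Leading small-`y` behaviour of the Bose coefficient `c_{a0}`.** For every `a` there is `C` such that for all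
`0 < y ≤ 1`:
`|∫₀^∞ (log u)^a (e^{u+y/u} − 1)⁻¹ du − (−1)^a (log(1/y)/2)^{a+1}/(a+1)| ≤ C·(1 + log(1/y))^a`.
[cite: KowalskiMichelVanderKam2000, (22)–(28) — derivation (leading residue of the diagonal weight, real-variable form)] -/
theorem bose_coeff_a0_leading (a : ℕ) : ∃ C : ℝ, ∀ y : ℝ, 0 < y → y ≤ 1 →
    |(∫ u in Ioi (0 : ℝ), Real.log u ^ a * (Real.exp (u + y / u) - 1)⁻¹) -
        (-1) ^ a * (Real.log (1 / y) / 2) ^ (a + 1) / ((a : ℝ) + 1)| ≤ C * (1 + Real.log (1 / y)) ^ a := by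
  -- the universal constant
  set M : ℝ := ∫ u in Ioi (0 : ℝ), Real.exp (-(u / 2)) * |Real.log u| ^ a with hM
  have hMint := integrableOn_exp_neg_half_mul_abs_logPow a
  have hM0 : 0 ≤ M := setIntegral_nonneg measurableSet_Ioi fun u _ ↦ by positivity
  set A₀ : ℝ := (max (a : ℝ) 1) ^ a with hA₀
  have hA₀0 : 0 ≤ A₀ := by positivity
  refine ⟨2 * M + Real.exp (1 / 2) / 2 * M + 2 ^ a * (1 + A₀) + 1, fun y hy0 hy1 ↦ ?_⟩
  -- notation
  set s : ℝ := Real.sqrt y with hs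
  have hs0 : 0 < s := Real.sqrt_pos.2 hy0
  have hs1 : s ≤ 1 := (Real.sqrt_le_sqrt hy1).trans_eq Real.sqrt_one
  have hsy : s ^ 2 = y := Real.sq_sqrt hy0.le
  set L : ℝ := Real.log (1 / y) with hL
  have hLdef : L = -Real.log y := by rw [hL, one_div, Real.log_inv]
  have hL0 : 0 ≤ L := by rw [hLdef]; have := Real.log_nonpos hy0.le hy1; linarith
  have hlogs : Real.log s = -(L / 2) := by rw [hs, Real.log_sqrt hy0.le, hLdef]; ring
  have habslogs : |Real.log s| = L / 2 := by rw [hlogs, abs_neg, abs_of_nonneg (by positivity)]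
  set K : ℝ → ℝ := fun u ↦ (Real.exp (u + y / u) - 1)⁻¹ with hK
  set R : ℝ → ℝ := fun u ↦ u / (u ^ 2 + y) with hR
  have hKnn : ∀ u, 0 < u → 0 ≤ K u := fun u hu ↦ scriptW_integrand_nonneg hy0.le hu
  -- (I) a global domination `K u ≤ C₁ e^{-u/2}` and integrability on `(0, ∞)`
  set C₁ : ℝ := (Real.exp (2 * s) - 1)⁻¹ * Real.exp (1 / 2) + 2 with hC₁
  have hE0 : 0 < (Real.exp (2 * s) - 1)⁻¹ := inv_pos.2 (sub_pos.2 (Real.one_lt_exp_iff.2 (by positivity)))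
  have hKdom : ∀ u, 0 < u → K u ≤ C₁ * Real.exp (-(u / 2)) := by
    intro u hu
    have h1 : K u ≤ (Real.exp (2 * s) - 1)⁻¹ := scriptW_integrand_le_const hy0 hu
    rcases le_or_gt u 1 with hu1 | hu1
    · have he : 1 ≤ Real.exp (1 / 2) * Real.exp (-(u / 2)) := by
        rw [← Real.exp_add]; exact Real.one_le_exp (by linarith)
      calc K u ≤ (Real.exp (2 * s) - 1)⁻¹ * 1 := by rw [mul_one]; exact h1
        _ ≤ (Real.exp (2 * s) - 1)⁻¹ * (Real.exp (1 / 2) * Real.exp (-(u / 2))) :=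
            mul_le_mul_of_nonneg_left he hE0.le
        _ ≤ C₁ * Real.exp (-(u / 2)) := by
            rw [hC₁]; nlinarith [Real.exp_pos (-(u / 2))]
    · have h2 : K u ≤ 2 * Real.exp (-u) := bose0_kernel_le_two_exp_neg hu1.le hy0.le
      have h3 : Real.exp (-u) ≤ Real.exp (-(u / 2)) := Real.exp_le_exp.2 (by linarith)
      calc K u ≤ 2 * Real.exp (-(u / 2)) := h2.trans (by linarith)
        _ ≤ C₁ * Real.exp (-(u / 2)) := by
            apply mul_le_mul_of_nonneg_right _ (Real.exp_pos _).le
            rw [hC₁]; nlinarith [Real.exp_pos (1 / 2)]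
  have hKcont : ContinuousOn K (Ioi 0) := continuousOn_scriptW_integrand hy0.le
  have hlogcont : ContinuousOn (fun u : ℝ ↦ Real.log u ^ a) (Ioi 0) :=
    (continuousOn_log.mono fun u hu ↦ ne_of_gt hu).pow a
  have hg_int : IntegrableOn (fun u ↦ Real.log u ^ a * K u) (Ioi 0) := by
    refine Integrable.mono' (hMint.const_mul C₁) ((hlogcont.mul hKcont).aestronglyMeasurable measurableSet_Ioi)
      (ae_restrict_of_forall_mem measurableSet_Ioi fun u hu ↦ ?_)
    have hu : 0 < u := hu
    rw [Real.norm_eq_abs, abs_mul, abs_of_nonneg (hKnn u hu), abs_pow]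
    calc |Real.log u| ^ a * K u ≤ |Real.log u| ^ a * (C₁ * Real.exp (-(u / 2))) :=
          mul_le_mul_of_nonneg_left (hKdom u hu) (by positivity)
      _ = C₁ * (Real.exp (-(u / 2)) * |Real.log u| ^ a) := by ring
  -- (II) split at `u = 1`
  have hsub1 : Ioc (0 : ℝ) 1 ⊆ Ioi 0 := Ioc_subset_Ioi_self
  have hsub2 : Ioi (1 : ℝ) ⊆ Ioi 0 := Ioi_subset_Ioi zero_le_one
  have hdisj : Disjoint (Ioc (0 : ℝ) 1) (Ioi 1) := by
    rw [Set.disjoint_left]; intro u h1 h2; exact absurd (mem_Ioi.1 h2) (not_lt.2 h1.2)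
  have hsplit : ∫ u in Ioi (0 : ℝ), Real.log u ^ a * K u =
      (∫ u in Ioc (0 : ℝ) 1, Real.log u ^ a * K u) + ∫ u in Ioi (1 : ℝ), Real.log u ^ a * K u := by
    rw [← setIntegral_union hdisj measurableSet_Ioi (hg_int.mono_set hsub1) (hg_int.mono_set hsub2),
      Ioc_union_Ioi_eq_Ioi zero_le_one]
  -- (III) the range `u ≥ 1` is `O(1)`
  have hA : |∫ u in Ioi (1 : ℝ), Real.log u ^ a * K u| ≤ 2 * M := by
    have h1 : |∫ u in Ioi (1 : ℝ), Real.log u ^ a * K u| ≤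
        ∫ u in Ioi (1 : ℝ), 2 * (Real.exp (-(u / 2)) * |Real.log u| ^ a) := by
      rw [← Real.norm_eq_abs]
      refine norm_integral_le_of_norm_le ((hMint.mono_set hsub2).const_mul 2)
        (ae_restrict_of_forall_mem measurableSet_Ioi fun u hu ↦ ?_)
      have hu : 1 < u := hu
      rw [Real.norm_eq_abs, abs_mul, abs_of_nonneg (hKnn u (by linarith)), abs_pow]
      have hk : K u ≤ 2 * Real.exp (-u) := bose0_kernel_le_two_exp_neg hu.le hy0.le
      have h3 : Real.exp (-u) ≤ Real.exp (-(u / 2)) := Real.exp_le_exp.2 (by linarith)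
      calc |Real.log u| ^ a * K u ≤ |Real.log u| ^ a * (2 * Real.exp (-(u / 2))) :=
            mul_le_mul_of_nonneg_left (hk.trans (by linarith)) (by positivity)
        _ = 2 * (Real.exp (-(u / 2)) * |Real.log u| ^ a) := by ring
    have h2 : ∫ u in Ioi (1 : ℝ), 2 * (Real.exp (-(u / 2)) * |Real.log u| ^ a) ≤
        ∫ u in Ioi (0 : ℝ), 2 * (Real.exp (-(u / 2)) * |Real.log u| ^ a) :=
      setIntegral_mono_set (hMint.const_mul 2) (ae_of_all _ fun u ↦ by positivity) hsub2.eventuallyLE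
    calc _ ≤ _ := h1
      _ ≤ _ := h2
      _ = 2 * M := by rw [MeasureTheory.integral_const_mul]
  -- (IV) `|log u|^a` is integrable on `(0,1]`
  have hpt1 : ∀ u ∈ Ioc (0 : ℝ) 1, |Real.log u| ^ a ≤ Real.exp (1 / 2) * (Real.exp (-(u / 2)) * |Real.log u| ^ a) := by
    intro u hu
    have he : 1 ≤ Real.exp (1 / 2) * Real.exp (-(u / 2)) := by
      rw [← Real.exp_add]; exact Real.one_le_exp (by linarith [hu.2])
    calc |Real.log u| ^ a = |Real.log u| ^ a * 1 := (mul_one _).symm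
      _ ≤ |Real.log u| ^ a * (Real.exp (1 / 2) * Real.exp (-(u / 2))) := mul_le_mul_of_nonneg_left he (by positivity)
      _ = Real.exp (1 / 2) * (Real.exp (-(u / 2)) * |Real.log u| ^ a) := by ring
  have hlogabs_int : IntegrableOn (fun u : ℝ ↦ |Real.log u| ^ a) (Ioc 0 1) := by
    refine Integrable.mono' ((hMint.mono_set hsub1).const_mul (Real.exp (1 / 2)))
      ((by fun_prop : Measurable fun u : ℝ ↦ |Real.log u| ^ a).aestronglyMeasurable)
      (ae_restrict_of_forall_mem measurableSet_Ioc fun u hu ↦ ?_)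
    rw [Real.norm_eq_abs, abs_pow, abs_abs]
    exact hpt1 u hu
  have hlogabs_le : ∫ u in Ioc (0 : ℝ) 1, |Real.log u| ^ a ≤ Real.exp (1 / 2) * M := by
    calc ∫ u in Ioc (0 : ℝ) 1, |Real.log u| ^ a
        ≤ ∫ u in Ioc (0 : ℝ) 1, Real.exp (1 / 2) * (Real.exp (-(u / 2)) * |Real.log u| ^ a) :=
          setIntegral_mono_on hlogabs_int ((hMint.mono_set hsub1).const_mul _) measurableSet_Ioc hpt1
      _ ≤ ∫ u in Ioi (0 : ℝ), Real.exp (1 / 2) * (Real.exp (-(u / 2)) * |Real.log u| ^ a) :=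
          setIntegral_mono_set (hMint.const_mul _) (ae_of_all _ fun u ↦ by positivity) hsub1.eventuallyLE
      _ = Real.exp (1 / 2) * M := by rw [MeasureTheory.integral_const_mul]
  -- (V) on `(0,1]`: replace the kernel by the rational weight
  have hRcont : ContinuousOn R (Ioi 0) := by
    refine ContinuousOn.div continuousOn_id (by fun_prop) fun u hu ↦ ?_
    have hu : 0 < u := hu
    positivity
  have hRnn : ∀ u, 0 < u → 0 ≤ R u := fun u hu ↦ (rational_weight_le_inv hu hy0.le).1
  have hR_int : IntegrableOn (fun u ↦ Real.log u ^ a * R u) (Ioc 0 1) := by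
    refine Integrable.mono' (hlogabs_int.const_mul (1 / y))
      (((hlogcont.mul hRcont).mono hsub1).aestronglyMeasurable measurableSet_Ioc)
      (ae_restrict_of_forall_mem measurableSet_Ioc fun u hu ↦ ?_)
    rw [Real.norm_eq_abs, abs_mul, abs_of_nonneg (hRnn u hu.1), abs_pow]
    have h1 : R u ≤ u / y := rational_weight_le_div hu.1 hy0
    have h2 : u / y ≤ 1 / y := div_le_div_of_nonneg_right hu.2 hy0.le
    calc |Real.log u| ^ a * R u ≤ |Real.log u| ^ a * (1 / y) := mul_le_mul_of_nonneg_left (h1.trans h2) (by positivity)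
      _ = 1 / y * |Real.log u| ^ a := mul_comm _ _
  have hK_int1 : IntegrableOn (fun u ↦ Real.log u ^ a * K u) (Ioc 0 1) := hg_int.mono_set hsub1
  have hdiff : IntegrableOn (fun u ↦ Real.log u ^ a * (K u - R u)) (Ioc 0 1) :=
    (hK_int1.sub hR_int).congr_fun (fun u _ ↦ by simp only [Pi.sub_apply]; ring) measurableSet_Ioc
  have hB : ∫ u in Ioc (0 : ℝ) 1, Real.log u ^ a * K u =
      (∫ u in Ioc (0 : ℝ) 1, Real.log u ^ a * R u) + ∫ u in Ioc (0 : ℝ) 1, Real.log u ^ a * (K u - R u) := by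
    rw [← integral_add hR_int hdiff]
    exact setIntegral_congr_fun measurableSet_Ioc fun u _ ↦ by ring
  have hB2 : |∫ u in Ioc (0 : ℝ) 1, Real.log u ^ a * (K u - R u)| ≤ Real.exp (1 / 2) / 2 * M := by
    have h1 : |∫ u in Ioc (0 : ℝ) 1, Real.log u ^ a * (K u - R u)| ≤ ∫ u in Ioc (0 : ℝ) 1, 1 / 2 * |Real.log u| ^ a := by
      rw [← Real.norm_eq_abs]
      refine norm_integral_le_of_norm_le (hlogabs_int.const_mul (1 / 2))
        (ae_restrict_of_forall_mem measurableSet_Ioc fun u hu ↦ ?_)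
      rw [Real.norm_eq_abs, abs_mul, abs_pow]
      have h := abs_bose0_kernel_sub_le hu.1 hy0.le
      calc |Real.log u| ^ a * |K u - R u| ≤ |Real.log u| ^ a * (1 / 2) := mul_le_mul_of_nonneg_left h (by positivity)
        _ = 1 / 2 * |Real.log u| ^ a := mul_comm _ _
    rw [MeasureTheory.integral_const_mul] at h1
    have := mul_le_mul_of_nonneg_left hlogabs_le (by norm_num : (0 : ℝ) ≤ 1 / 2)
    linarith
  -- (VI) the rational weight: split `(0,1]` at `s`
  have hsubs1 : Ioc (0 : ℝ) s ⊆ Ioc 0 1 := Ioc_subset_Ioc_right hs1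
  have hsubs2 : Ioc s 1 ⊆ Ioc (0 : ℝ) 1 := Ioc_subset_Ioc_left hs0.le
  have hdisj2 : Disjoint (Ioc (0 : ℝ) s) (Ioc s 1) := by
    rw [Set.disjoint_left]; intro u h1 h2; exact absurd h2.1 (not_lt.2 h1.2)
  have hsplit2 : ∫ u in Ioc (0 : ℝ) 1, Real.log u ^ a * R u =
      (∫ u in Ioc (0 : ℝ) s, Real.log u ^ a * R u) + ∫ u in Ioc s 1, Real.log u ^ a * R u := by
    rw [← setIntegral_union hdisj2 measurableSet_Ioc (hR_int.mono_set hsubs1) (hR_int.mono_set hsubs2),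
      Ioc_union_Ioc_eq_Ioc hs0.le hs1]
  -- (VI a) below `s`
  have hB1a : |∫ u in Ioc (0 : ℝ) s, Real.log u ^ a * R u| ≤ 2 ^ a * ((L / 2) ^ a + A₀) := by
    have hvol : volume (Ioc (0 : ℝ) s) < ⊤ := by rw [Real.volume_Ioc]; exact ENNReal.ofReal_lt_top
    have h := norm_setIntegral_le_of_norm_le_const hvol (f := fun u ↦ Real.log u ^ a * R u)
      (C := 2 ^ a * (|Real.log s| ^ a + A₀) * s / y) fun u hu ↦ by
        rw [Real.norm_eq_abs, abs_mul, abs_of_nonneg (hRnn u hu.1), abs_pow]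
        have h1 : R u ≤ u / y := rational_weight_le_div hu.1 hy0
        have h2 := abs_log_pow_mul_le a hu.1 hu.2 hs1
        calc |Real.log u| ^ a * R u ≤ |Real.log u| ^ a * (u / y) := mul_le_mul_of_nonneg_left h1 (by positivity)
          _ = |Real.log u| ^ a * u / y := by ring
          _ ≤ 2 ^ a * (|Real.log s| ^ a + (max (a : ℝ) 1) ^ a) * s / y := div_le_div_of_nonneg_right h2 hy0.le
    rw [Real.norm_eq_abs, Real.volume_real_Ioc, sub_zero, max_eq_left hs0.le, habslogs] at h
    refine h.trans (le_of_eq ?_)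
    have hss : s * s / y = 1 := by rw [← pow_two, hsy, div_self hy0.ne']
    calc 2 ^ a * ((L / 2) ^ a + A₀) * s / y * s = 2 ^ a * ((L / 2) ^ a + A₀) * (s * s / y) := by ring
      _ = 2 ^ a * ((L / 2) ^ a + A₀) := by rw [hss, mul_one]
  -- (VI b) on `[s, 1]`: `R = 1/u − y/(u(u²+y))`
  have hcont_main : ContinuousOn (fun u : ℝ ↦ Real.log u ^ a / u) (Icc s 1) := by
    refine ContinuousOn.div ((continuousOn_log.mono fun u hu ↦ ?_).pow a) continuousOn_id fun u hu ↦ ?_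
    · exact ne_of_gt (lt_of_lt_of_le hs0 hu.1)
    · exact ne_of_gt (lt_of_lt_of_le hs0 hu.1)
  have hcont_tail : ContinuousOn (fun u : ℝ ↦ Real.log u ^ a * (y / (u * (u ^ 2 + y)))) (Icc s 1) := by
    refine ContinuousOn.mul ((continuousOn_log.mono fun u hu ↦ ?_).pow a)
      (ContinuousOn.div continuousOn_const (by fun_prop) fun u hu ↦ ?_)
    · exact ne_of_gt (lt_of_lt_of_le hs0 hu.1)
    · have : 0 < u := lt_of_lt_of_le hs0 hu.1
      positivity
  have hint_main : IntegrableOn (fun u : ℝ ↦ Real.log u ^ a / u) (Ioc s 1) :=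
    (hcont_main.integrableOn_Icc).mono_set Ioc_subset_Icc_self
  have hint_tail : IntegrableOn (fun u : ℝ ↦ Real.log u ^ a * (y / (u * (u ^ 2 + y)))) (Ioc s 1) :=
    (hcont_tail.integrableOn_Icc).mono_set Ioc_subset_Icc_self
  have hB1b : ∫ u in Ioc s 1, Real.log u ^ a * R u =
      (∫ u in Ioc s 1, Real.log u ^ a / u) - ∫ u in Ioc s 1, Real.log u ^ a * (y / (u * (u ^ 2 + y))) := by
    rw [← integral_sub hint_main hint_tail]
    refine setIntegral_congr_fun measurableSet_Ioc fun u hu ↦ ?_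
    have hu0 : 0 < u := hs0.trans hu.1
    simp only [hR]
    rw [rational_weight_eq hu0 hy0.le]
    ring
  have hmain : ∫ u in Ioc s 1, Real.log u ^ a / u = (-1) ^ a * (L / 2) ^ (a + 1) / ((a : ℝ) + 1) := by
    rw [← intervalIntegral.integral_of_le hs1, integral_log_pow_div_eq a hs0 hs1, hlogs, neg_pow, pow_succ]
    ring
  have htail : |∫ u in Ioc s 1, Real.log u ^ a * (y / (u * (u ^ 2 + y)))| ≤ (L / 2) ^ a / 2 := by
    have hcont3 : ContinuousOn (fun u : ℝ ↦ |Real.log s| ^ a * (y / u ^ 3)) (Icc s 1) :=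
      ContinuousOn.mul continuousOn_const
        (ContinuousOn.div continuousOn_const (continuousOn_pow 3) fun u hu ↦
          pow_ne_zero 3 (ne_of_gt (lt_of_lt_of_le hs0 hu.1)))
    have hint3 : IntegrableOn (fun u : ℝ ↦ |Real.log s| ^ a * (y / u ^ 3)) (Ioc s 1) :=
      (hcont3.integrableOn_Icc).mono_set Ioc_subset_Icc_self
    have h1 : |∫ u in Ioc s 1, Real.log u ^ a * (y / (u * (u ^ 2 + y)))| ≤
        ∫ u in Ioc s 1, |Real.log s| ^ a * (y / u ^ 3) := by
      rw [← Real.norm_eq_abs]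
      refine norm_integral_le_of_norm_le hint3 (ae_restrict_of_forall_mem measurableSet_Ioc fun u hu ↦ ?_)
      have hu0 : 0 < u := hs0.trans hu.1
      obtain ⟨ht0, ht⟩ := rational_weight_tail_le hu0 hy0.le
      rw [Real.norm_eq_abs, abs_mul, abs_pow, abs_of_nonneg ht0]
      have hl : |Real.log u| ^ a ≤ |Real.log s| ^ a :=
        pow_le_pow_left₀ (abs_nonneg _) (abs_log_le_abs_log hs0 hu.1.le hu.2) a
      exact mul_le_mul hl ht ht0 (by positivity)
    have h2 : ∫ u in Ioc s 1, |Real.log s| ^ a * (y / u ^ 3) = |Real.log s| ^ a * (y / (2 * s ^ 2) - y / 2) := by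
      rw [MeasureTheory.integral_const_mul, ← intervalIntegral.integral_of_le hs1, integral_div_cube_eq y hs0 hs1]
    rw [h2, habslogs, hsy] at h1
    refine h1.trans ?_
    have hyy : y / (2 * y) - y / 2 ≤ 1 / 2 := by
      have hy' : y ≠ 0 := hy0.ne'
      rw [show y / (2 * y) = 1 / 2 by field_simp]
      linarith
    calc (L / 2) ^ a * (y / (2 * y) - y / 2) ≤ (L / 2) ^ a * (1 / 2) :=
          mul_le_mul_of_nonneg_left hyy (by positivity)
      _ = (L / 2) ^ a / 2 := by ring
  -- (VII) assemble
  have hL2 : (L / 2) ^ a ≤ (1 + L) ^ a := pow_le_pow_left₀ (by positivity) (by linarith) a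
  have h1L : 1 ≤ (1 + L) ^ a := one_le_pow₀ (by linarith)
  rw [hsplit, hB, hsplit2, hB1b, hmain]
  have e : ∀ (b1a mn tl b2 aa : ℝ), b1a + (mn - tl) + b2 + aa - mn = b1a - tl + b2 + aa := fun _ _ _ _ _ ↦ by ring
  rw [e]
  calc |(∫ u in Ioc (0 : ℝ) s, Real.log u ^ a * R u) -
          (∫ u in Ioc s 1, Real.log u ^ a * (y / (u * (u ^ 2 + y)))) +
          (∫ u in Ioc (0 : ℝ) 1, Real.log u ^ a * (K u - R u)) + ∫ u in Ioi (1 : ℝ), Real.log u ^ a * K u|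
      ≤ |∫ u in Ioc (0 : ℝ) s, Real.log u ^ a * R u| +
          |∫ u in Ioc s 1, Real.log u ^ a * (y / (u * (u ^ 2 + y)))| +
          |∫ u in Ioc (0 : ℝ) 1, Real.log u ^ a * (K u - R u)| + |∫ u in Ioi (1 : ℝ), Real.log u ^ a * K u| := by
        refine (abs_add_le _ _).trans (add_le_add ((abs_add_le _ _).trans (add_le_add (abs_sub _ _) le_rfl)) le_rfl)
    _ ≤ 2 ^ a * ((L / 2) ^ a + A₀) + (L / 2) ^ a / 2 + Real.exp (1 / 2) / 2 * M + 2 * M :=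
        add_le_add (add_le_add (add_le_add hB1a htail) hB2) hA
    _ ≤ (2 * M + Real.exp (1 / 2) / 2 * M + 2 ^ a * (1 + A₀) + 1) * (1 + L) ^ a := by
        set P : ℝ := (1 + L) ^ a with hP
        have hP0 : 0 ≤ P := by positivity
        have i1 : 2 ^ a * ((L / 2) ^ a + A₀) ≤ 2 ^ a * (1 + A₀) * P := by
          have hA : A₀ ≤ A₀ * P := le_mul_of_one_le_right hA₀0 h1L
          have : (L / 2) ^ a + A₀ ≤ (1 + A₀) * P := by nlinarith
          calc 2 ^ a * ((L / 2) ^ a + A₀) ≤ 2 ^ a * ((1 + A₀) * P) :=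
                mul_le_mul_of_nonneg_left this (by positivity)
            _ = 2 ^ a * (1 + A₀) * P := by ring
        have i2 : (L / 2) ^ a / 2 ≤ 1 * P := by
          have : 0 ≤ (L / 2) ^ a := by positivity
          linarith
        have i3 : Real.exp (1 / 2) / 2 * M ≤ Real.exp (1 / 2) / 2 * M * P :=
          le_mul_of_one_le_right (by positivity) h1L
        have i4 : 2 * M ≤ 2 * M * P := le_mul_of_one_le_right (by positivity) h1L
        nlinarith

end Summit.Parity.GeneralizedHardyLittlewood.Theorems.MomentsBeyondDiagonal.DiagLines

end
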